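import Summits.BirchSwinnertonDyer.BirchSwinnertonDyer.Theorems.CountingDoorF2AtThreeDoorFamily
import HarnessLib

/-!
# BirchSwinnertonDyer / CountingDoorF2AtThree — crux I4loc `SchneiderOnDoorSubfamily`
# (stmt-BirchSwinnertonDyer-19682), line `valuation-class-at-three` (v3): the SIEVE-CLASS FAMILY
# `Φ** = F₂ ∩ {a ≡ r mod 9} ∩ {a ≡ r mod 25} ∩ {a ≡ r mod 7} ∩ {ℓ² ∤ Δ(a), ℓ ∉ {3,5,7}}`

Support theorem S1 of the line (memo `HOME/p2/PADIC-R2-G11.md` §2; eng-2 STATUS 15:12:14Z «S1 = family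
facts for Φ**»): the first FIVE conjuncts of the registered v3 stub `stub_heightDigits` — a large
congruence subfamily with nonempty residue sets and an explicit member, the local door conditions of
`Theorems.leaf_of_local` member-wise, and the square-free sieve `ℓ² ∤ Δ(a)` at EVERY prime — built
GENERICALLY from one representative `r : Params` whose local data are decidable numerics:

* `exists_sieveClassFamily r …` — hypotheses on `r` only: `3 ∤ Δ(r)`, `3 ∤ a₃(E_r)` (good ordinary
  at `3`), `ord₅ Δ(r) = 1` (multiplicative at `5`, `ord₅ Δ_min = 1`), `7 ∤ Δ(r)` with Mazur's Frobenius
  certificate `X² − a₇(E_r) X + 7` root-free mod `3` (`ρ̄₃` irreducible), and `ℓ² ∤ Δ(r)` for all `ℓ`;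
  conclusion: `∃ Φ : CongruenceFamily₂` with `Φ.IsLarge`, every residue set nonempty, `Φ.Mem r`, the
  MEMBERSHIP CHARACTERISATION `Φ.Mem a ↔ Δ(a) ≠ 0 ∧ a ≡ r (mod 9) ∧ a ≡ r (mod 25) ∧ a ≡ r (mod 7) ∧
  ∀ ℓ ∉ {3,5,7} prime, ℓ² ∤ Δ(a)` (casts in `ZMod (3^2)`, `ZMod (5^2)`, `ZMod 7`), and for every member
  the door conditions (verbatim I4loc clause) together with `∀ ℓ prime, ℓ² ∤ Δ(a)`.
  The sieve residue set at a prime `ℓ ∉ {3,5,7}` is typed WITHOUT a new definition as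
  `{ρ mod ℓ² | ∃ b ≡ ρ (mod ℓ²), ℓ² ∤ Δ(b)}` (well defined by class-constancy,
  `F2Member.dvd_Δ_iff_of_cast_eq`), so `Φ.IsLarge` holds BY DEFINITION of "large at `ℓ`"; the local
  conditions transfer from `r` to the class by the `F2Member.*_of_cast_eq` lemmas, exactly as in
  `Theorems.exists_doorFamily` (the door family `Φ₀`, which this family refines at `3` and sieves).
* `exists_sieveClassFamily_star` — the instance of record for the deciding class `c = (7,0,4,0) mod 9`
  (eng-2 T12.md §4–§5, skeleton v3): representative = explicit member
  `a* = (−524, 450, −374, 3825)` (`≡ (7,0,4,0) mod 9`, `≡ (1,0,1,0) mod 25`, `≡ (1,2,4,3) mod 7`), with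
  `Δ(a*) = 293685505917206658977765 = 5·19·41·43·71·1129·1559·21503·652543` (nine distinct primes:
  square-free, `ord₅ = 1`, `3, 7 ∤`), `a₃(E_{a*}) = −2` and `a₇(E_{a*}) = 0` read off the door family's
  representatives through class-constancy (`a* ≡ (1,0,1,0) mod 3`, `≡ (1,2,4,3) mod 7`).
Everything is decided by `norm_num` / `decide` on the representative; no analytic input. PARTITION:
none — r_an ≥ 2, summit axis S0; TWIN (D-0056): n/a. B1 honesty: local algebra of Weierstrass
models; nothing here mentions a Selmer group, an `L`-value, a height or the analytic rank.
Helper file `--supports stmt-BirchSwinnertonDyer-19682`; it closes nothing by itself.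

References: M. Bhargava, W. Ho, arXiv:2207.03309 §1 (large subfamilies of `F₂`) [BhargavaHo2022];
B. Mazur, Invent. Math. 44 (1978) Prop. 6.3 (1) [Mazur1978]; J. H. Silverman, *AEC* (2009) VII.1,
VII.5 [SilvermanAEC2009].
-/

set_option linter.dupNamespace false

noncomputable section

open scoped Classical
open WeierstrassCurve Literature.NumberTheory.EllipticCurves
  Literature.NumberTheory.EllipticCurves.BhargavaHo2022
  Summit.BirchSwinnertonDyer.Rank2

namespace Summit.BirchSwinnertonDyer.BirchSwinnertonDyer.Theorems

/-! ### Bookkeeping -/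

/-- A square-free integer has no prime-square divisor. [folklore] -/
theorem not_sq_dvd_of_squarefree {z : ℤ} (hz : Squarefree z) (ℓ : ℕ) (hℓ : ℓ.Prime) :
    ¬ ((ℓ : ℤ) ^ 2 ∣ z) := by
  intro h
  rw [sq] at h
  have hu := hz (ℓ : ℤ) h
  rw [Int.ofNat_isUnit, Nat.isUnit_iff] at hu
  exact hℓ.one_lt.ne' hu

/-! ### The sieve-class family of a representative -/

/-- **The sieve-class family of a representative `r`.** Let `r : Params` have `3 ∤ Δ(r)`,
`3 ∤ a₃(E_r)`, `ord₅ Δ(r) = 1`, `7 ∤ Δ(r)` with `X² − a₇(E_r)X + 7` root-free modulo `3`, and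
`ℓ² ∤ Δ(r)` for every prime `ℓ`. Then there is a subfamily `Φ` of `F₂` defined by congruence
conditions — `a ≡ r (mod 9)`, `a ≡ r (mod 25)`, `a ≡ r (mod 7)`, and `ℓ² ∤ Δ(a)` at every other prime
`ℓ` (a condition on `a mod ℓ²`) — which is large (no member with `ℓ² ∤ Δ` is excluded at `ℓ ≥ 8`), has
nonempty residue sets and the member `r`, whose membership is CHARACTERISED by these congruences, and
all of whose members have irreducible `ρ̄₃`, every globally minimal model good ordinary at `3` and
multiplicative at `5` with `3 ∤ ord₅ Δ_min = 1`, and square-free-sieved discriminant `ℓ² ∤ Δ(a)` at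
every prime. [cite: BhargavaHo2022, §1 (large subfamilies defined by congruence conditions)] -/
theorem exists_sieveClassFamily (r : Params)
    (h3Δ : ¬ ((3 : ℤ) ∣ r.curveInt.Δ))
    (h3ord : ¬ ((3 : ℤ) ∣ Literature.NumberTheory.Automorphic.frobeniusTrace r.curveInt 3))
    (h5 : padicValInt 5 r.curveInt.Δ = 1)
    (h7Δ : ¬ ((7 : ℤ) ∣ r.curveInt.Δ))
    (h7cert : ∀ t : ZMod 3,
      t ^ 2 - (Literature.NumberTheory.Automorphic.frobeniusTrace r.curveInt 7 : ZMod 3) * t +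
        (7 : ZMod 3) ≠ 0)
    (hsq : ∀ ℓ : ℕ, ℓ.Prime → ¬ ((ℓ : ℤ) ^ 2 ∣ r.curveInt.Δ)) :
    ∃ Φ : CongruenceFamily₂, Φ.IsLarge ∧ (∀ p : ℕ, p.Prime → (Φ.residues p).Nonempty) ∧ Φ.Mem r ∧
      (∀ a : Params, Φ.Mem a ↔ a.IsMember ∧
        ((a.a₁ : ZMod (3 ^ 2)) = r.a₁ ∧ (a.a₂ : ZMod (3 ^ 2)) = r.a₂ ∧
          (a.a₂' : ZMod (3 ^ 2)) = r.a₂' ∧ (a.a₃ : ZMod (3 ^ 2)) = r.a₃) ∧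
        ((a.a₁ : ZMod (5 ^ 2)) = r.a₁ ∧ (a.a₂ : ZMod (5 ^ 2)) = r.a₂ ∧
          (a.a₂' : ZMod (5 ^ 2)) = r.a₂' ∧ (a.a₃ : ZMod (5 ^ 2)) = r.a₃) ∧
        ((a.a₁ : ZMod 7) = r.a₁ ∧ (a.a₂ : ZMod 7) = r.a₂ ∧
          (a.a₂' : ZMod 7) = r.a₂' ∧ (a.a₃ : ZMod 7) = r.a₃) ∧
        ∀ ℓ : ℕ, ℓ.Prime → ℓ ≠ 3 → ℓ ≠ 5 → ℓ ≠ 7 → ¬ ((ℓ : ℤ) ^ 2 ∣ a.curveInt.Δ)) ∧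
      (∀ a : Params, Φ.Mem a →
        (a.curve.HasIrreducibleModPGaloisRep 3 ∧
          ∀ (C : VariableChange ℚ) (hC : (C • a.curve).IsGloballyMinimal),
            @IsOrdinaryAt (C • a.curve) hC 3 _ ∧ ∃ ℓ : ℕ, ∃ _ : Fact ℓ.Prime, ℓ ≠ 3 ∧
              (C • a.curve).HasMultiplicativeReductionAtPrime ℓ ∧
              ¬ 3 ∣ padicValInt ℓ (@minimalDiscriminantInt (C • a.curve) hC)) ∧
        ∀ ℓ : ℕ, ℓ.Prime → ¬ ((ℓ : ℤ) ^ 2 ∣ a.curveInt.Δ)) := by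
  haveI : Fact (Nat.Prime 5) := ⟨by norm_num⟩
  haveI : Fact (Nat.Prime 7) := ⟨by norm_num⟩
  -- the family, remembered only through the unfolding of its residue conditions
  obtain ⟨Φ, hΦ⟩ : ∃ Φ : CongruenceFamily₂, ∀ (p : ℕ) (a : Params),
      Φ.residueOf p a ∈ Φ.residues p ↔ ∃ b : Params,
        ((b.a₁ : ZMod (p ^ 2)) = a.a₁ ∧ (b.a₂ : ZMod (p ^ 2)) = a.a₂ ∧
          (b.a₂' : ZMod (p ^ 2)) = a.a₂' ∧ (b.a₃ : ZMod (p ^ 2)) = a.a₃) ∧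
        ((p = 3 ∨ p = 5) → (b.a₁ : ZMod (p ^ 2)) = r.a₁ ∧ (b.a₂ : ZMod (p ^ 2)) = r.a₂ ∧
          (b.a₂' : ZMod (p ^ 2)) = r.a₂' ∧ (b.a₃ : ZMod (p ^ 2)) = r.a₃) ∧
        (p = 7 → (b.a₁ : ZMod 7) = r.a₁ ∧ (b.a₂ : ZMod 7) = r.a₂ ∧
          (b.a₂' : ZMod 7) = r.a₂' ∧ (b.a₃ : ZMod 7) = r.a₃) ∧
        ((p ≠ 3 ∧ p ≠ 5 ∧ p ≠ 7) → ¬ ((p : ℤ) ^ 2 ∣ b.curveInt.Δ)) :=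
    ⟨⟨fun _ ↦ 2, fun p ↦ {ρ | ∃ b : Params,
        ((b.a₁ : ZMod (p ^ 2)) = ρ.1 ∧ (b.a₂ : ZMod (p ^ 2)) = ρ.2.1 ∧
          (b.a₂' : ZMod (p ^ 2)) = ρ.2.2.1 ∧ (b.a₃ : ZMod (p ^ 2)) = ρ.2.2.2) ∧
        ((p = 3 ∨ p = 5) → (b.a₁ : ZMod (p ^ 2)) = r.a₁ ∧ (b.a₂ : ZMod (p ^ 2)) = r.a₂ ∧
          (b.a₂' : ZMod (p ^ 2)) = r.a₂' ∧ (b.a₃ : ZMod (p ^ 2)) = r.a₃) ∧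
        (p = 7 → (b.a₁ : ZMod 7) = r.a₁ ∧ (b.a₂ : ZMod 7) = r.a₂ ∧
          (b.a₂' : ZMod 7) = r.a₂' ∧ (b.a₃ : ZMod 7) = r.a₃) ∧
        ((p ≠ 3 ∧ p ≠ 5 ∧ p ≠ 7) → ¬ ((p : ℤ) ^ 2 ∣ b.curveInt.Δ))}⟩,
      fun _ _ ↦ Iff.rfl⟩
  -- `r` is a member of `F₂`
  have hr : r.IsMember := fun h0 ↦ h3Δ (h0 ▸ dvd_zero 3)
  -- membership characterisation
  have key : ∀ a : Params, Φ.Mem a ↔ a.IsMember ∧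
      ((a.a₁ : ZMod (3 ^ 2)) = r.a₁ ∧ (a.a₂ : ZMod (3 ^ 2)) = r.a₂ ∧
        (a.a₂' : ZMod (3 ^ 2)) = r.a₂' ∧ (a.a₃ : ZMod (3 ^ 2)) = r.a₃) ∧
      ((a.a₁ : ZMod (5 ^ 2)) = r.a₁ ∧ (a.a₂ : ZMod (5 ^ 2)) = r.a₂ ∧
        (a.a₂' : ZMod (5 ^ 2)) = r.a₂' ∧ (a.a₃ : ZMod (5 ^ 2)) = r.a₃) ∧
      ((a.a₁ : ZMod 7) = r.a₁ ∧ (a.a₂ : ZMod 7) = r.a₂ ∧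
        (a.a₂' : ZMod 7) = r.a₂' ∧ (a.a₃ : ZMod 7) = r.a₃) ∧
      ∀ ℓ : ℕ, ℓ.Prime → ℓ ≠ 3 → ℓ ≠ 5 → ℓ ≠ 7 → ¬ ((ℓ : ℤ) ^ 2 ∣ a.curveInt.Δ) := by
    intro a
    constructor
    · rintro ⟨ha, hres⟩
      obtain ⟨b₃, ⟨e₁, e₂, e₂', e₃⟩, hc₃, -, -⟩ := (hΦ 3 a).mp (hres 3 Nat.prime_three)
      obtain ⟨f₁, f₂, f₂', f₃⟩ := hc₃ (Or.inl rfl)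
      obtain ⟨b₅, ⟨g₁, g₂, g₂', g₃⟩, hc₅, -, -⟩ := (hΦ 5 a).mp (hres 5 (by norm_num))
      obtain ⟨k₁, k₂, k₂', k₃⟩ := hc₅ (Or.inr rfl)
      obtain ⟨b₇, ⟨m₁, m₂, m₂', m₃⟩, -, hc₇, -⟩ := (hΦ 7 a).mp (hres 7 (by norm_num))
      obtain ⟨n₁, n₂, n₂', n₃⟩ := hc₇ rfl
      refine ⟨ha, ⟨e₁ ▸ f₁, e₂ ▸ f₂, e₂' ▸ f₂', e₃ ▸ f₃⟩, ⟨g₁ ▸ k₁, g₂ ▸ k₂, g₂' ▸ k₂', g₃ ▸ k₃⟩,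
        ⟨?_, ?_, ?_, ?_⟩, ?_⟩
      · rw [← intCast_zmod_eq_of_sq (p := 7) m₁]; exact n₁
      · rw [← intCast_zmod_eq_of_sq (p := 7) m₂]; exact n₂
      · rw [← intCast_zmod_eq_of_sq (p := 7) m₂']; exact n₂'
      · rw [← intCast_zmod_eq_of_sq (p := 7) m₃]; exact n₃
      · intro ℓ hℓ h3 h5 h7 hdvd
        obtain ⟨b, ⟨o₁, o₂, o₂', o₃⟩, -, -, hcs⟩ := (hΦ ℓ a).mp (hres ℓ hℓ)
        refine hcs ⟨h3, h5, h7⟩ ?_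
        have hiff := F2Member.dvd_Δ_iff_of_cast_eq (n := ℓ ^ 2) o₁ o₂ o₂' o₃
        push_cast at hiff
        exact hiff.mpr hdvd
    · rintro ⟨ha, ⟨f₁, f₂, f₂', f₃⟩, ⟨k₁, k₂, k₂', k₃⟩, ⟨n₁, n₂, n₂', n₃⟩, hsieve⟩
      refine ⟨ha, fun p hp ↦ (hΦ p a).mpr ⟨a, ⟨rfl, rfl, rfl, rfl⟩, ?_, ?_, ?_⟩⟩
      · rintro (rfl | rfl)
        · exact ⟨f₁, f₂, f₂', f₃⟩
        · exact ⟨k₁, k₂, k₂', k₃⟩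
      · rintro rfl
        exact ⟨n₁, n₂, n₂', n₃⟩
      · rintro ⟨h3, h5, h7⟩
        exact hsieve p hp h3 h5 h7
  -- `r` is a member of `Φ`
  have hrMem : Φ.Mem r :=
    (key r).mpr ⟨hr, ⟨rfl, rfl, rfl, rfl⟩, ⟨rfl, rfl, rfl, rfl⟩, ⟨rfl, rfl, rfl, rfl⟩,
      fun ℓ hℓ _ _ _ ↦ hsq ℓ hℓ⟩
  refine ⟨Φ, ?_, fun p hp ↦ ⟨_, hrMem.2 p hp⟩, hrMem, key, fun a ha ↦ ?_⟩
  · -- large at every prime `p ≥ 8`: there the condition IS `p² ∤ Δ`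
    refine ⟨8, fun p h8 _ a _ hnd ↦ (hΦ p a).mpr ⟨a, ⟨rfl, rfl, rfl, rfl⟩, ?_, ?_, fun _ ↦ hnd⟩⟩
    · rintro (rfl | rfl) <;> omega
    · rintro rfl; omega
  · -- member-wise local data and the sieve at every prime
    obtain ⟨haM, ⟨f₁, f₂, f₂', f₃⟩, ⟨k₁, k₂, k₂', k₃⟩, ⟨n₁, n₂, n₂', n₃⟩, hsieve⟩ := (key a).mp ha
    -- the class of `a` modulo `3` is that of `r`
    have e₁ : (a.a₁ : ZMod 3) = r.a₁ := intCast_zmod_eq_of_sq (p := 3) f₁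
    have e₂ : (a.a₂ : ZMod 3) = r.a₂ := intCast_zmod_eq_of_sq (p := 3) f₂
    have e₂' : (a.a₂' : ZMod 3) = r.a₂' := intCast_zmod_eq_of_sq (p := 3) f₂'
    have e₃ : (a.a₃ : ZMod 3) = r.a₃ := intCast_zmod_eq_of_sq (p := 3) f₃
    have ha3 : ¬ ((3 : ℕ) : ℤ) ∣ a.curveInt.Δ := by
      rw [F2Member.dvd_Δ_iff_of_cast_eq e₁ e₂ e₂' e₃]; exact_mod_cast h3Δ
    have ha5 : padicValInt 5 a.curveInt.Δ = 1 :=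
      (F2Member.padicValInt_Δ_eq_one_iff_of_cast_eq k₁ k₂ k₂' k₃).mpr h5
    have ha7 : ¬ ((7 : ℕ) : ℤ) ∣ a.curveInt.Δ := by
      rw [F2Member.dvd_Δ_iff_of_cast_eq n₁ n₂ n₂' n₃]; exact_mod_cast h7Δ
    refine ⟨⟨?_, fun C hC ↦ ?_⟩, ?_⟩
    · -- irreducible `ρ̄₃`: Frobenius certificate at `7` on the class representative
      have h := F2Member.hasIrreducibleModPGaloisRep_smul_curve_of_cast_eq (a := a)
        (1 : VariableChange ℚ) 3 7 (by norm_num) n₁ n₂ n₂' n₃ (by exact_mod_cast h7Δ) h7cert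
      rwa [one_smul] at h
    · haveI := hC
      refine ⟨F2Member.isOrdinaryAt_smul_curve a C 3 ha3 ?_, ?_⟩
      · rw [F2Member.frobeniusTrace_eq_of_cast_eq e₁ e₂ e₂' e₃]; exact_mod_cast h3ord
      · exact F2Member.haux_smul_curve a C (ℓ := 5) le_rfl ha5 3 Nat.prime_three (by norm_num)
    · -- the square-free sieve at every prime
      intro ℓ hℓ
      by_cases h3 : ℓ = 3
      · subst h3
        intro h
        exact ha3 (dvd_trans (dvd_pow_self _ two_ne_zero) (by exact_mod_cast h))
      by_cases h5' : ℓ = 5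
      · subst h5'
        exact ((padicValInt_eq_one_iff _).mp ha5).2
      by_cases h7 : ℓ = 7
      · subst h7
        intro h
        exact ha7 (dvd_trans (dvd_pow_self _ two_ne_zero) (by exact_mod_cast h))
      exact hsieve ℓ hℓ h3 h5' h7

/-! ### The instance of record: class `c = (7,0,4,0) mod 9`, representative `a* = (−524, 450, −374, 3825)` -/

/-- The integer model of the member `a* = (−524, 450, −374, 3825)` of `F₂` is
`y² − 524xy + 3825y = x³ − 174076x − 12790800` (`[−524, 0, 3825, −174076, −12790800]`).
[cite: BhargavaHo2022, §1 (definition of F₂)] -/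
theorem curveInt_repStar :
    (⟨-524, 450, -374, 3825⟩ : Params).curveInt = ⟨-524, 0, 3825, -174076, -12790800⟩ := by
  simp [Params.curveInt]

/-- Its discriminant is `293685505917206658977765 = 5·19·41·43·71·1129·1559·21503·652543`
(eng-2 T12.md §5). [cite: BhargavaHo2022, §1 (the discriminant polynomial Δ)] -/
theorem Δ_repStar : (⟨-524, 450, -374, 3825⟩ : Params).curveInt.Δ = 293685505917206658977765 := by
  rw [curveInt_repStar]
  simp [WeierstrassCurve.Δ, WeierstrassCurve.b₂, WeierstrassCurve.b₄, WeierstrassCurve.b₆,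
    WeierstrassCurve.b₈]

/-- `Δ(a*)` is square-free: it is the product of the nine distinct primes
`5, 19, 41, 43, 71, 1129, 1559, 21503, 652543`. [folklore] -/
theorem squarefree_Δ_repStar : Squarefree (⟨-524, 450, -374, 3825⟩ : Params).curveInt.Δ := by
  rw [Δ_repStar, ← Int.squarefree_natAbs]
  have hN : Int.natAbs 293685505917206658977765 =
      5 * (19 * (41 * (43 * (71 * (1129 * (1559 * (21503 * 652543))))))) := by norm_num
  rw [hN]
  have sf : ∀ {p : ℕ}, p.Prime → Squarefree p := fun hp ↦ Irreducible.squarefree hp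
  refine (Nat.squarefree_mul (by norm_num)).mpr ⟨sf (by norm_num), ?_⟩
  refine (Nat.squarefree_mul (by norm_num)).mpr ⟨sf (by norm_num), ?_⟩
  refine (Nat.squarefree_mul (by norm_num)).mpr ⟨sf (by norm_num), ?_⟩
  refine (Nat.squarefree_mul (by norm_num)).mpr ⟨sf (by norm_num), ?_⟩
  refine (Nat.squarefree_mul (by norm_num)).mpr ⟨sf (by norm_num), ?_⟩
  refine (Nat.squarefree_mul (by norm_num)).mpr ⟨sf (by norm_num), ?_⟩
  refine (Nat.squarefree_mul (by norm_num)).mpr ⟨sf (by norm_num), ?_⟩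
  exact (Nat.squarefree_mul (by norm_num)).mpr ⟨sf (by norm_num), sf (by norm_num)⟩

/-- `a* ≡ (1,0,1,0) (mod 3)`: the class of the door family's representative at `3`, so
`a₃(E_{a*}) = a₃(E_{(1,0,1,0)}) = −2` by class-constancy. [folklore] -/
theorem frobeniusTrace_repStar_three :
    Literature.NumberTheory.Automorphic.frobeniusTrace (⟨-524, 450, -374, 3825⟩ : Params).curveInt 3
      = -2 := by
  rw [← frobeniusTrace_rep₃_three]
  exact F2Member.frobeniusTrace_eq_of_cast_eq (a := ⟨-524, 450, -374, 3825⟩) (r := ⟨1, 0, 1, 0⟩)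
    (n := 3) (by decide) (by decide) (by decide) (by decide)

/-- `a* ≡ (1,2,4,3) (mod 7)`: the class of the door family's representative at `7`, so
`a₇(E_{a*}) = a₇(E_{(1,2,4,3)}) = 0` by class-constancy. [folklore] -/
theorem frobeniusTrace_repStar_seven :
    Literature.NumberTheory.Automorphic.frobeniusTrace (⟨-524, 450, -374, 3825⟩ : Params).curveInt 7
      = 0 := by
  rw [← frobeniusTrace_rep₇_seven]
  exact F2Member.frobeniusTrace_eq_of_cast_eq (a := ⟨-524, 450, -374, 3825⟩) (r := ⟨1, 2, 4, 3⟩)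
    (n := 7) (by decide) (by decide) (by decide) (by decide)

/-- **The sieve-class family of the valuation class `(7,0,4,0) mod 9`** (skeleton v3 of line
`valuation-class-at-three`, class and member of record from eng-2 T12.md §4–§5): there is a large
subfamily `Φ** = F₂ ∩ {a ≡ (7,0,4,0) mod 9} ∩ {a ≡ (1,0,1,0) mod 25} ∩ {a ≡ (1,2,4,3) mod 7} ∩
{ℓ² ∤ Δ(a), ℓ ∉ {3,5,7}}` with nonempty residue sets and the member `a* = (−524, 450, −374, 3825)`,
membership CHARACTERISED by these congruences (residues as numerals in `ZMod 9`, `ZMod 25`, `ZMod 7`),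
and, for every member: the local door conditions of `Theorems.leaf_of_local` (verbatim I4loc clause),
the square-free sieve `ℓ² ∤ Δ(a)` at EVERY prime, and the door class `a ≡ (1,0,1,0) (mod 3)` — the
first five conjuncts of the registered stub `stub_heightDigits`, leaving exactly the digit certificate.
[cite: BhargavaHo2022, §1 (large subfamilies defined by congruence conditions)] -/
theorem exists_sieveClassFamily_star :
    ∃ Φ : CongruenceFamily₂, Φ.IsLarge ∧ (∀ p : ℕ, p.Prime → (Φ.residues p).Nonempty) ∧
      Φ.Mem ⟨-524, 450, -374, 3825⟩ ∧
      (∀ a : Params, Φ.Mem a ↔ a.IsMember ∧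
        ((a.a₁ : ZMod 9) = 7 ∧ (a.a₂ : ZMod 9) = 0 ∧ (a.a₂' : ZMod 9) = 4 ∧ (a.a₃ : ZMod 9) = 0) ∧
        ((a.a₁ : ZMod 25) = 1 ∧ (a.a₂ : ZMod 25) = 0 ∧ (a.a₂' : ZMod 25) = 1 ∧
          (a.a₃ : ZMod 25) = 0) ∧
        ((a.a₁ : ZMod 7) = 1 ∧ (a.a₂ : ZMod 7) = 2 ∧ (a.a₂' : ZMod 7) = 4 ∧ (a.a₃ : ZMod 7) = 3) ∧
        ∀ ℓ : ℕ, ℓ.Prime → ℓ ≠ 3 → ℓ ≠ 5 → ℓ ≠ 7 → ¬ ((ℓ : ℤ) ^ 2 ∣ a.curveInt.Δ)) ∧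
      (∀ a : Params, Φ.Mem a →
        (a.curve.HasIrreducibleModPGaloisRep 3 ∧
          ∀ (C : VariableChange ℚ) (hC : (C • a.curve).IsGloballyMinimal),
            @IsOrdinaryAt (C • a.curve) hC 3 _ ∧ ∃ ℓ : ℕ, ∃ _ : Fact ℓ.Prime, ℓ ≠ 3 ∧
              (C • a.curve).HasMultiplicativeReductionAtPrime ℓ ∧
              ¬ 3 ∣ padicValInt ℓ (@minimalDiscriminantInt (C • a.curve) hC)) ∧
        (∀ ℓ : ℕ, ℓ.Prime → ¬ ((ℓ : ℤ) ^ 2 ∣ a.curveInt.Δ)) ∧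
        ((a.a₁ : ZMod 3) = 1 ∧ (a.a₂ : ZMod 3) = 0 ∧ (a.a₂' : ZMod 3) = 1 ∧ (a.a₃ : ZMod 3) = 0)) := by
  haveI : Fact (Nat.Prime 5) := ⟨by norm_num⟩
  obtain ⟨Φ, hL, hne, hmem, hchar, hloc⟩ :=
    exists_sieveClassFamily ⟨-524, 450, -374, 3825⟩ (by rw [Δ_repStar]; norm_num)
      (by rw [frobeniusTrace_repStar_three]; norm_num)
      (by rw [Δ_repStar, padicValInt_eq_one_iff]; norm_num) (by rw [Δ_repStar]; norm_num)
      (by rw [frobeniusTrace_repStar_seven]; decide) (not_sq_dvd_of_squarefree squarefree_Δ_repStar)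
  -- the representative's residues, as numerals
  have h9₁ : (((⟨-524, 450, -374, 3825⟩ : Params).a₁ : ℤ) : ZMod (3 ^ 2)) = 7 := by decide
  have h9₂ : (((⟨-524, 450, -374, 3825⟩ : Params).a₂ : ℤ) : ZMod (3 ^ 2)) = 0 := by decide
  have h9₂' : (((⟨-524, 450, -374, 3825⟩ : Params).a₂' : ℤ) : ZMod (3 ^ 2)) = 4 := by decide
  have h9₃ : (((⟨-524, 450, -374, 3825⟩ : Params).a₃ : ℤ) : ZMod (3 ^ 2)) = 0 := by decide
  have h25₁ : (((⟨-524, 450, -374, 3825⟩ : Params).a₁ : ℤ) : ZMod (5 ^ 2)) = 1 := by decide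
  have h25₂ : (((⟨-524, 450, -374, 3825⟩ : Params).a₂ : ℤ) : ZMod (5 ^ 2)) = 0 := by decide
  have h25₂' : (((⟨-524, 450, -374, 3825⟩ : Params).a₂' : ℤ) : ZMod (5 ^ 2)) = 1 := by decide
  have h25₃ : (((⟨-524, 450, -374, 3825⟩ : Params).a₃ : ℤ) : ZMod (5 ^ 2)) = 0 := by decide
  have h7₁ : (((⟨-524, 450, -374, 3825⟩ : Params).a₁ : ℤ) : ZMod 7) = 1 := by decide
  have h7₂ : (((⟨-524, 450, -374, 3825⟩ : Params).a₂ : ℤ) : ZMod 7) = 2 := by decide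
  have h7₂' : (((⟨-524, 450, -374, 3825⟩ : Params).a₂' : ℤ) : ZMod 7) = 4 := by decide
  have h7₃ : (((⟨-524, 450, -374, 3825⟩ : Params).a₃ : ℤ) : ZMod 7) = 3 := by decide
  have hchar' : ∀ a : Params, Φ.Mem a ↔ a.IsMember ∧
      ((a.a₁ : ZMod 9) = 7 ∧ (a.a₂ : ZMod 9) = 0 ∧ (a.a₂' : ZMod 9) = 4 ∧ (a.a₃ : ZMod 9) = 0) ∧
      ((a.a₁ : ZMod 25) = 1 ∧ (a.a₂ : ZMod 25) = 0 ∧ (a.a₂' : ZMod 25) = 1 ∧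
        (a.a₃ : ZMod 25) = 0) ∧
      ((a.a₁ : ZMod 7) = 1 ∧ (a.a₂ : ZMod 7) = 2 ∧ (a.a₂' : ZMod 7) = 4 ∧ (a.a₃ : ZMod 7) = 3) ∧
      ∀ ℓ : ℕ, ℓ.Prime → ℓ ≠ 3 → ℓ ≠ 5 → ℓ ≠ 7 → ¬ ((ℓ : ℤ) ^ 2 ∣ a.curveInt.Δ) := by
    intro a
    have hc := hchar a
    rw [h9₁, h9₂, h9₂', h9₃, h25₁, h25₂, h25₂', h25₃, h7₁, h7₂, h7₂', h7₃] at hc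
    exact hc
  refine ⟨Φ, hL, hne, hmem, hchar', fun a ha ↦ ⟨(hloc a ha).1, (hloc a ha).2, ?_⟩⟩
  -- the door class modulo `3`, read off the class modulo `9`
  obtain ⟨-, ⟨e₁, e₂, e₂', e₃⟩, -⟩ := (hchar' a).mp ha
  exact ⟨(intCast_zmod_eq_of_sq (p := 3) (y := 7) (by rw [Int.cast_ofNat]; exact e₁)).trans
      (by decide),
    (intCast_zmod_eq_of_sq (p := 3) (y := 0) (by rw [Int.cast_zero]; exact e₂)).trans (by decide),
    (intCast_zmod_eq_of_sq (p := 3) (y := 4) (by rw [Int.cast_ofNat]; exact e₂')).trans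
      (by decide),
    (intCast_zmod_eq_of_sq (p := 3) (y := 0) (by rw [Int.cast_zero]; exact e₃)).trans (by decide)⟩

end Summit.BirchSwinnertonDyer.BirchSwinnertonDyer.Theorems

end
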